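import Summits.ABC.IUTFork.Cor312StatementBridge
import Summits.ABC.IUTFork.Thm311MultiradProofs
import HarnessLib

/-!
# [IUTchIII] Cor. 3.12, proof Steps (x)–(xii) OVER the typed Theorem 3.11: what is consumed, what is proved, what is the licence

Record-only file (D-0012) of the abc-iut cell (Cor. 3.12 crew, seat abc-iut-c312-1, gen 3); TAKES NO SIDE.
Sequel to the seat's typing of [IUTchIII] Theorem 3.11 (files A–L: `Thm311Sig` … `Thm311LinkGlue`) and written
OVER abc-iut-c312-7's verbatim `Cor312.Setting`/`Cor312.Setting.Statement` (Cor. 3.12 as printed) and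
abc-iut-c312-6's bridge `Cor312Vol.BridgeHyps`/`toCor312Setting` (verbatim statement ↔ skeleton `Cor312Setting`).
It answers, IN THE KERNEL, the planning question «which parts of Theorem 3.11 do Steps (x)–(xii) of the proof of
Cor. 3.12 invoke, and with what effect» (S. Mochizuki, *Inter-universal Teichmüller theory III*, kurims manuscript
May 2020 = `paper:url-4b091feeb646`, proof of Cor. 3.12 pp. 174–186, READ ON THE PAGE: (x) p. 180 l. 43 – p. 181;
(xi-a)–(xi-h) pp. 181–185; (xii) pp. 185–186).

| printed step | invokes (as printed) | typed referent (seat · file) | kernel status here |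
|---|---|---|---|
| (x) «log-volumes … invariant with respect to (Ind1), (Ind2) [cf. Prop. 3.9, (ii)]» | Thm 3.11 (i) (a), (c); Prop 3.9 (ii) | B `MRData.LogvolInvariant` (generator level) + L6-t13 orbit theorem | `logvol_eq_of_mem_possibleImages`: PROVED from the named invariance (a property of the INSTANTIATION, not of Thm 3.11 as typed) |
| (x) «converting the indeterminacy (Ind3) into an inequality [from above]» | Thm 3.11 (ii) (Ind3) | C `Column.Ind3`; c312-7 `thetaRegion3 = ⋃ₘ` | `logvol_thetaRegion_le_thetaHull`: PROVED from monotonicity (c312-6 `LogvolMono`) |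
| (x) «log-link compatibility of the various log-volumes [Prop. 3.9 (iv); final portion of Thm 3.11 (ii)]» | Thm 3.11 (ii) final clause | C `Column.LogvolPrecise` | C `logvolPrecise_of_kummerA` (gen 0): bookkeeping |
| (xi-a) Θ×μ_LGP-link as gluing; «Θ-pilot object at (0,0) … corresponds to the q-pilot object at (1,0)» (Step (i), Rmk 3.8.1) | Def 3.8 (ii); Rmk 3.8.1 | D `LinkData.horizontal` (unit portion, FULL poly-iso); `PilotLink` below (value-group portion, OBJECT level) | hypothesis structure; holds in the witness of §4 |
| (xi-b) «`⁰˒°𝒰 ⥲ ¹˒°𝒰` … arises from the permutation symmetries discussed in the final portion of Theorem 3.11, (i)» | Thm 3.11 (i), final portion | B `Situation.MultiradialCompat` | `possibleImages_eq_of_multiradialCompat`: PROVED — two columns' possible-image families COINCIDE, given (i) and a functorial region algorithm (`RegionAlgorithm`, Prop 3.9 (iii)) |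
| (xi-b)/(xi-c) (IPL) «linked … via (full poly-)isomorphisms of `𝓕^⊩▶`-prime-strips» | Rmk 3.11.1 (iii) | F `LinkData.IPL` | F `ipl_of_connected` (gen 0): holds whenever strips are isomorphic |
| (xi-c)–(xi-e) (SHE) «expressed entirely relative to the arithmetic holomorphic structure in the 1-column»; (APT), (HIS) | Rmk 3.11.1 (iii)–(v) | no kernel shadow beyond B (`MRData` lives on the coric `LogShells`) — F, table row p. 161–162 | prose; nothing to consume |
| (xi-d) «`ℝ_{≤−|log(Θ)|} ⊆ ℝ; −|log(q)| ∈ ℝ`» | Prop 3.9 (iii); Rmk 3.9.5 (vii)–(ix) | c312-7 `negLogTheta`/`negLogQ`; c312-2 `Cor312Chain.Volumes` | definitions |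
| (xi-f) «subject to the condition that this construction … constitutes … a construction … of `−|log(q)|` … The inclusion `−|log(q)| ∈ ℝ_{≤−|log(Θ)|}` … then follows formally» | (xi-e) | `Licence` below (= skel `Cor312Setting.QSubHull` of c312-6's `toCor312Setting`, `licence_iff_qSubHull`; the target of c312-2's `hLicOfThm` in `DAGC312j`) | `statement_of_licence` (c312-6's edge): Licence ⟹ Statement. CONVERSELY `Checks.independence`: Thm 3.11 (i)∧(ii)∧(iii) as typed + (IPL) + invariance + every catalogued side condition do NOT yield the Statement — one model satisfies them all with `−|log(Θ)| = −2 < −1 = −|log(q)|` |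
| (xi-g)/(xi-h), Fig. 3.8; (xii) global realified Frobenioids | [EtTh]; [IUTchIV] Rmk 2.3.2 (ii); Rmk 3.6.2 (i) | interpretive | prose; (xi-h)'s «false for `N ≥ 2`» is a constraint on MODELS (lit/SOURCES.md §1), not typable here |

READING of the outcome (neutral). At the level at which the cell has typed Theorem 3.11 — signatures for the
objects, the author's sub-items (i)(a)(b)(c), (ii)(a)(b)(c)/(Ind3), (iii)(a)–(d) as `Prop`s — the proof's
Steps (x) and (xi-b) are THEOREMS (given the two instantiation properties «log-volume is (Ind1)/(Ind2)-invariant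
and monotone», [IUTchIII] Prop. 3.9 (i)(ii), and «regions are assigned functorially», Prop. 3.9 (iii)), while Step
(xi-f) is NOT a consequence of the typed premises: `Checks.independence` exhibits a model of ALL of them in which the
printed inequality fails. Hence any kernel route from Theorem 3.11 to Corollary 3.12 must supply the `Licence`
(Reading 2 of the skeleton; Readings 1/3 imply it up to volumes) from content the present typing does not carry —
the author locates that content in (IPL)/(SHE)/(APT) (Rmk. 3.11.1 (iii)–(v), Step (xi-e) «expressibility …
amounts precisely to …»), Scholze–Stix deny it (§2.2), LANA §9 replace it by (9-1). This file takes no side: it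
records which inference carries the weight and that nothing else typed so far does. The witness is the
"identified copies" shape in miniature (one valuation, trivial strip-automorphisms and Ism, the Θ-pilot region the
zero ideal, the q-pilot region everything, a two-valued monotone log-volume): it is NOT a model of the initial
Θ-data of [IUTchI] Def. 3.1 and says nothing about the truth of Cor. 3.12 for such data.

Sources read on the page: [IUTchIII] pp. 174–175 (opening, Step (i)), 180–186 (Steps (x)–(xii)), 153–158 (Thm.
3.11), 159–163 (Rmk. 3.11.1); Scholze–Stix 2018 §2.2; LANA report §8.3 p. 43, §9 (9-1) p. 46 (`paper:url-7e4c7f9f3efc`).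
[claim: Mochizuki2012, status: disputed] [cite: LANA2026Report, §8.3 p. 43]
Deliberately NOT here: any M-level instance (abc-iut-c312-5 `Thm311Real*`, abc-iut-c312-3 DH model); the
proof chain as a DAG (abc-iut-c312-2 `Cor312Steps`/`Cor312Chain`); any judgement.
-/

noncomputable section

namespace Summit.ABC.IUTFork

namespace Thm311ToCor312

open Thm311 Cor312

variable {T : ThetaIndex}

/-! ## 1. Step (x): (Ind1), (Ind2) do not move log-volumes; (Ind3) becomes an inequality from above -/

/-- **Step (x), first clause** (p. 181: «the resulting log-volumes ∈ ℝ are invariant with respect to the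
indeterminacies (Ind1), (Ind2) [one verifies immediately — cf. Proposition 3.9, (ii)]»), over c312-7's setting:
IF the data (a) of the column `n` has (Ind1)/(Ind2)-invariant log-volume at the generator level (B's
`MRData.LogvolInvariant`, with admissibility transported by the generating families — properties of the
INSTANTIATION, [IUTchIII] Prop. 3.9 (ii); Dupuy–Hilado §4.7–4.10), then EVERY possible image of the Θ-pilot
object is admissible and has the log-volume of the (Ind3)-enlarged region. Via the orbit theorem
`MRData.adm_and_logvol_eq_of_mem_closure` (`Thm311MultiradProofs`); the `PilotNouns`-level twin is
`PilotNouns.logvol_eq_of_mem_possibleImages_of_logvolInvariant` (`Thm311PilotProofs`). [claim: Mochizuki2012, status: disputed] -/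
theorem logvol_eq_of_mem_possibleImages {S : Situation T} (P : Setting S)
    (hAdm : ∀ Φ ∈ S.L.Ind1Family ∪ S.L.Ind2Family, ∀ j vQ (A : Set (S.L.Packet j vQ)),
      (S.D P.n).Adm j vQ A ↔ (S.D P.n).Adm j vQ (Φ j vQ '' A))
    (hvol : (S.D P.n).LogvolInvariant) {j : T.Label} {vQ : T.VQ}
    (hadm : (S.D P.n).Adm j vQ (P.thetaRegion3 j vQ))
    {U : Set (S.L.Packet j vQ)} (hU : U ∈ P.possibleImages j vQ) :
    (S.D P.n).Adm j vQ U ∧ (S.D P.n).logvol j vQ U = (S.D P.n).logvol j vQ (P.thetaRegion3 j vQ) := by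
  obtain ⟨Φ, hΦ, rfl⟩ := hU
  exact MRData.adm_and_logvol_eq_of_mem_closure (S.D P.n) hAdm hvol hΦ j vQ _ hadm

/-- **Step (x), second clause** (p. 181: the log-volumes «have the effect of converting the indeterminacy
(Ind3) into an inequality [from above]»): each Kummer image `thetaRegion m` of the Θ-pilot object (one per `m ∈ ℤ`,
Thm. 3.11 (ii)) lies in the (Ind3)-enlarged region `⋃ₘ`, hence in the hull `ⁿ˒°𝒰_{j,v_ℚ}` of the union of the
possible images, so — log-volume being MONOTONE (c312-6 `LogvolMono`, [IUTchIII] Prop. 3.9 (i)) — its log-volume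
is at most the local term of `−|log(Θ)|`. [claim: Mochizuki2012, status: disputed] -/
theorem logvol_thetaRegion_le_thetaHull {S : Situation T} (P : Setting S) (hmono : Cor312Vol.LogvolMono P)
    (i : Fin T.lstar) (vQ : T.VQ) (m : ℤ)
    (hadm : (S.D P.n).Adm (Setting.labelSucc i) vQ (P.thetaRegion m (Setting.labelSucc i) vQ))
    (hdef : P.HullDefined (Setting.labelSucc i) vQ) :
    (S.D P.n).logvol _ vQ (P.thetaRegion m (Setting.labelSucc i) vQ) ≤
      (S.D P.n).logvol _ vQ (P.thetaHull (Setting.labelSucc i) vQ) :=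
  hmono i vQ hadm (P.thetaHull_adm hdef)
    ((Set.subset_iUnion (fun m => P.thetaRegion m (Setting.labelSucc i) vQ) m).trans
      ((Set.subset_sUnion_of_mem (P.thetaRegion3_mem_possibleImages _ vQ)).trans
        ((P.frame _ vQ).subset_hull _)))

/-! ## 2. Step (xi-b): `⁰˒°𝒰 ⥲ ¹˒°𝒰` from the final portion of Theorem 3.11 (i) -/

/-- A REGION ALGORITHM on the multiradial data: to the data (a)(b)(c) of a vertical line ([IUTchIII] Thm. 3.11
(i)) it assigns the (Ind3)-enlarged region of the Θ-pilot object in each packet `𝓘^ℚ(^{S^±_{j+1}};ⁿ˒°𝒟^⊢_{v_ℚ})`,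
FUNCTORIALLY: transporting the data along an indeterminacy transports the region (Thm. 3.11 (i) «may be
constructed via an algorithm in the procession of 𝒟^⊢-prime-strips … that is functorial with respect to
isomorphisms of processions»; Prop. 3.9 (iii) «the elements of "𝕄(−)" determined by objects»; Rmk. 3.9.5 (vii)
(Ob3)). HYPOTHESIS structure — the instantiation's recipe (e.g. Dupuy–Hilado's `q^{j²}·𝒪^{Ind3}`), no claim.
[claim: Mochizuki2012, status: disputed] -/
structure RegionAlgorithm (S : Situation T) where
  /-- data (a)(b)(c) ↦ the (Ind3)-enlarged Θ-pilot region at `(j, v_ℚ)` -/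
  ρ : MRData S.L → ∀ (j : T.Label) (vQ : T.VQ), Set (S.L.Packet j vQ)
  /-- functoriality: the region of the transported data is the transported region -/
  equivariant : ∀ (D : MRData S.L) (Φ : S.L.PacketAut), Φ ∈ Setting.indGroup S →
    ∀ (j : T.Label) (vQ : T.VQ), ρ (D.map Φ) j vQ = Φ j vQ '' ρ D j vQ

/-- "The setting's Θ-pilot region IS the algorithm's output on the data of the setting's column" — the tie
between c312-7's glue field `thetaRegionOf` and the typed Theorem 3.11 (i)/(ii). [claim: Mochizuki2012, status: disputed] -/
@[claim "Mochizuki2012" "disputed"] def ComputedBy {S : Situation T} (P : Setting S) (A : RegionAlgorithm S) : Prop :=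
  ∀ (j : T.Label) (vQ : T.VQ), P.thetaRegion3 j vQ = A.ρ (S.D P.n) j vQ

/-- Under Theorem 3.11 (i) (`MultiradialCompat`, read through abc-iut-L6-t13's `exists_map_eq_of_multiradialCompat`:
the data of two columns differ by ONE indeterminacy `Φ`), the (Ind3)-enlarged Θ-pilot regions of two settings
computed by the same region algorithm differ by that `Φ`. [claim: Mochizuki2012, status: disputed] -/
theorem thetaRegion3_eq_image {S : Situation T} (A : RegionAlgorithm S) {P₀ P₁ : Setting S}
    (h₀ : ComputedBy P₀ A) (h₁ : ComputedBy P₁ A) {Φ : S.L.PacketAut} (hΦ : Φ ∈ Setting.indGroup S)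
    (e : S.D P₁.n = (S.D P₀.n).map Φ) (j : T.Label) (vQ : T.VQ) :
    P₁.thetaRegion3 j vQ = Φ j vQ '' P₀.thetaRegion3 j vQ := by
  rw [h₁ j vQ, h₀ j vQ, e]
  exact A.equivariant _ _ hΦ j vQ

/-- **Step (xi-b) PROVED at the typed level** (p. 181: «(⁰˒°𝒰^ℚ ⊇) ⁰˒°𝒰 ⥲ ¹˒°𝒰 (⊆ ¹˒°𝒰^ℚ) — where the
isomorphism "⥲" arises from the permutation symmetries discussed in the final portion of Theorem 3.11, (i)»). In
the bi-coric strictification of the typing (all vertical lines act on the same packets) the isomorphism is an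
EQUALITY: for two settings over the same situation (columns `n₀`, `n₁`) whose Θ-pilot regions are computed by one
region algorithm, Theorem 3.11 (i) implies that the families of possible images of the Θ-pilot object COINCIDE in
every packet. This is the precise sense in which c312-7's single setting at the column `n = 1` is the printed
`¹˒°𝒰`: the possible images computed from column 1's own data are those transported from column 0. What Theorem
3.11 (i) contributes to Cor. 3.12 is exactly this transfer. [claim: Mochizuki2012, status: disputed] -/
theorem possibleImages_eq_of_multiradialCompat {S : Situation T} (A : RegionAlgorithm S) {P₀ P₁ : Setting S}
    (h₀ : ComputedBy P₀ A) (h₁ : ComputedBy P₁ A) (hS : S.MultiradialCompat) (j : T.Label) (vQ : T.VQ) :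
    P₀.possibleImages j vQ = P₁.possibleImages j vQ := by
  obtain ⟨Φ, hΦ, e⟩ := S.exists_map_eq_of_multiradialCompat hS P₀.n P₁.n
  have key := thetaRegion3_eq_image A h₀ h₁ hΦ e j vQ
  ext U
  constructor
  · rintro ⟨Ψ, hΨ, rfl⟩
    refine ⟨Ψ * Φ⁻¹, mul_mem hΨ (inv_mem hΦ), ?_⟩
    rw [key, Set.image_image]
    refine Set.image_congr fun x _ => ?_
    change Ψ j vQ x = Ψ j vQ ((Φ j vQ).symm (Φ j vQ x))
    rw [LinearEquiv.symm_apply_apply]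
  · rintro ⟨Ψ, hΨ, rfl⟩
    refine ⟨Ψ * Φ, mul_mem hΨ hΦ, ?_⟩
    rw [key, Set.image_image]
    rfl

/-- Consequently the unions `⁰˒°𝒰_{j,v_ℚ}` and `¹˒°𝒰_{j,v_ℚ}` coincide (the hulls are then formed relative to the
arithmetic holomorphic structure of the column where the comparison is made — the setting's own `frame`).
[claim: Mochizuki2012, status: disputed] -/
theorem sUnion_possibleImages_eq_of_multiradialCompat {S : Situation T} (A : RegionAlgorithm S)
    {P₀ P₁ : Setting S} (h₀ : ComputedBy P₀ A) (h₁ : ComputedBy P₁ A) (hS : S.MultiradialCompat)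
    (j : T.Label) (vQ : T.VQ) : ⋃₀ P₀.possibleImages j vQ = ⋃₀ P₁.possibleImages j vQ := by
  rw [possibleImages_eq_of_multiradialCompat A h₀ h₁ hS j vQ]

/-- The log-volumes, too, transfer between columns under Theorem 3.11 (i), PROVIDED the column-`n₀` log-volume is
(Ind1)/(Ind2)-invariant (Step (x)): the column-`n₁` data (a), being the transport of the column-`n₀` data, assigns
to every `n₀`-admissible region the same admissibility and log-volume. So `−|log(Θ)|` may be read with either
column's mono-analytic log-volume. [claim: Mochizuki2012, status: disputed] -/
theorem logvol_eq_of_multiradialCompat (S : Situation T) (hS : S.MultiradialCompat) (n₀ n₁ : ℤ)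
    (hAdm : ∀ Φ ∈ S.L.Ind1Family ∪ S.L.Ind2Family, ∀ j vQ (A : Set (S.L.Packet j vQ)),
      (S.D n₀).Adm j vQ A ↔ (S.D n₀).Adm j vQ (Φ j vQ '' A))
    (hvol : (S.D n₀).LogvolInvariant) (j : T.Label) (vQ : T.VQ) (A : Set (S.L.Packet j vQ))
    (hA : (S.D n₀).Adm j vQ A) :
    (S.D n₁).Adm j vQ A ∧ (S.D n₁).logvol j vQ A = (S.D n₀).logvol j vQ A := by
  obtain ⟨Φ, hΦ, e⟩ := S.exists_map_eq_of_multiradialCompat hS n₀ n₁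
  rw [e]
  exact MRData.adm_and_logvol_eq_of_mem_closure (S.D n₀) hAdm hvol (inv_mem hΦ) j vQ A hA

/-! ## 3. Step (xi-a) at the object level, and the (xi-f) licence -/

/-- **Step (i)/(xi-a), object level** (p. 175, end of Step (i): the value group portion of the Θ×μ_LGP-link «maps Θ-pilot
objects of ⁰˒⁰𝓗𝓣^{Θ±ell NF} to q-pilot objects of ¹˒⁰𝓗𝓣^{Θ±ell NF} [cf. Remark 3.8.1]»; (xi-a) p. 181: «the Θ-pilot
object at (0,0) … corresponds to the q-pilot object at (1,0)»; Fig. 3.8): an identification of the objects [up to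
isomorphism] of the global realified Frobenioids `𝒞^⊩_lgp` and `𝒞^⊩_△` of the setting carrying the Θ-pilot object
to the q-pilot object. This is what the FULL poly-isomorphism `𝓕^⊩▶_LGP ⥲ 𝓕^⊩▶_△` of Def. 3.8 (ii) supplies at the
level of objects (Step (xii): it «only preserves isomorphism classes of objects»). HYPOTHESIS; any consequence
for REGIONS is the licence below. [claim: Mochizuki2012, status: disputed] -/
@[claim "Mochizuki2012" "disputed"] def PilotLink {S : Situation T} (P : Setting S) : Prop :=
  ∃ e : P.Ob P.sig.Clgp ≃ P.ObΔ, e P.thetaPilot = P.qPilot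

/-- **The (xi-f) LICENCE** in the vocabulary of the typed statement (p. 184: «the construction of the subset
`ℝ_{≤−|log(Θ)|} ⊆ ℝ` of possible pilot-object log-volumes of output data is subject to the condition that this
construction … constitutes … a construction [perhaps only up to some sort of "approximation" …] of the pilot-object
log-volume of the input data (𝓕^⊩▶×μ-)prime-strip, namely, `−|log(q)| ∈ ℝ`. The inclusion
`−|log(q)| ∈ ℝ_{≤−|log(Θ)|}` … then follows formally»), read at the level of regions (the skeleton's Reading 2,
`ForkRegions.Cor312Setting.QSubHull`; LANA §8.3 p. 43 «`−|log(q)| ∈ ℝ_{≤−|log(Θ)|}`»): in every packet at a label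
`j ∈ 𝔽_l^⋇`, the image of the q-pilot object lies in the holomorphic hull `ⁿ˒°𝒰_{j,v_ℚ}` of the union of the possible
images of the Θ-pilot object. HYPOTHESIS — the disputed inference, never asserted; it is the target of
abc-iut-c312-2's `hLicOfThm` (`DAGC312j`). [claim: Mochizuki2012, status: disputed] -/
@[claim "Mochizuki2012" "disputed"] def Licence {S : Situation T} (P : Setting S) : Prop :=
  ∀ (i : Fin T.lstar) (vQ : T.VQ), P.qRegion (Setting.labelSucc i) vQ ⊆ P.thetaHull (Setting.labelSucc i) vQ

/-- Licence ⟹ the printed Statement of Cor. 3.12 (abc-iut-c312-6's edge `statement_of_qRegion_subset_thetaHull`: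
monotonicity of the log-volume, under the bridge hypotheses). [claim: Mochizuki2012, status: disputed] -/
theorem statement_of_licence {S : Situation T} {P : Setting S} (H : Cor312Vol.BridgeHyps P) (h : Licence P) :
    P.Statement :=
  Cor312Vol.statement_of_qRegion_subset_thetaHull H h

/-- The licence IS the skeleton's Reading 2 (`QSubHull`: «the q-pilot image lies in the holomorphic hull of the
possible images») for the `Cor312Setting` abc-iut-c312-6 assembles from the verbatim setting. [folklore] -/
theorem licence_iff_qSubHull {S : Situation T} {P : Setting S} (H : Cor312Vol.BridgeHyps P) :
    Licence P ↔ (Cor312Vol.toCor312Setting H).QSubHull := by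
  show _ ↔ (Set.univ.pi fun t : Fin T.lstar × T.VQ => P.qRegion (Setting.labelSucc t.1) t.2) ⊆
    (Cor312Vol.toLocalFamily P H.mono).assemble.hull (⋃ U : Cor312Vol.ImageChoice P, Set.univ.pi U.1)
  rw [Cor312Vol.assemble_hull_iUnion H]
  constructor
  · intro h
    exact Set.pi_mono fun t _ => h t.1 t.2
  · intro h i vQ
    have hne : (Set.univ.pi fun t : Fin T.lstar × T.VQ => P.qRegion (Setting.labelSucc t.1) t.2).Nonempty :=
      Set.univ_pi_nonempty_iff.mpr fun t => H.hul_nonempty _ _ _ (P.qRegion_mem _ t.2)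
    rcases Set.pi_subset_pi_iff.mp h with h' | h'
    · exact h' (i, vQ) (Set.mem_univ _)
    · exact absurd h' hne.ne_empty

/-- Reading 3 («the q-pilot image IS a possible image», Fig. 3.8 «two tautologically equivalent ways to compute the
log-volume of the q-pilot object») implies the licence. [claim: Mochizuki2012, status: disputed] -/
theorem licence_of_qRegion_mem_possibleImages {S : Situation T} (P : Setting S)
    (h : ∀ (i : Fin T.lstar) (vQ : T.VQ), P.qRegion (Setting.labelSucc i) vQ ∈ P.possibleImages _ vQ) :
    Licence P :=
  fun i vQ => (Set.subset_sUnion_of_mem (h i vQ)).trans ((P.frame _ vQ).subset_hull _)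

/-! ## 4. A two-valued monotone log-volume (used by the vacuity audit `Thm311ToCor312Checks`) -/

open scoped Classical in
/-- A two-valued "ideal size" on subsets of a module: `−2` on subsets of the zero ideal, `−1` otherwise. [folklore] -/
def sizeVol {X : Type} [Zero X] (A : Set X) : ℝ := if A ⊆ {0} then -2 else -1

/-- `sizeVol` is monotone. [folklore] -/
theorem sizeVol_mono {X : Type} [Zero X] {A B : Set X} (h : A ⊆ B) : sizeVol A ≤ sizeVol B := by
  unfold sizeVol
  by_cases hB : B ⊆ {0}
  · rw [if_pos hB, if_pos (h.trans hB)]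
  · rw [if_neg hB]
    split_ifs <;> norm_num

/-- `sizeVol {0} = −2`. [folklore] -/
theorem sizeVol_zero {X : Type} [Zero X] : sizeVol ({0} : Set X) = -2 := if_pos subset_rfl

/-- Linear automorphisms preserve "being inside the zero ideal". [folklore] -/
theorem image_subset_zero_iff {X Y : Type} [AddCommGroup X] [AddCommGroup Y] [Module ℚ X] [Module ℚ Y]
    (e : X ≃ₗ[ℚ] Y) (A : Set X) : (e : X → Y) '' A ⊆ {0} ↔ A ⊆ {0} := by
  constructor
  · rintro h x hx
    have hx0 : e x ∈ ({0} : Set Y) := h ⟨x, hx, rfl⟩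
    rw [Set.mem_singleton_iff, LinearEquiv.map_eq_zero_iff] at hx0
    exact hx0
  · rintro h _ ⟨x, hx, rfl⟩
    have hx0 : x = 0 := h hx
    rw [hx0, map_zero]
    exact Set.mem_singleton 0

/-- … hence preserve `sizeVol`. [folklore] -/
theorem sizeVol_image {X Y : Type} [AddCommGroup X] [AddCommGroup Y] [Module ℚ X] [Module ℚ Y]
    (e : X ≃ₗ[ℚ] Y) (A : Set X) : sizeVol ((e : X → Y) '' A) = sizeVol A := by
  unfold sizeVol
  by_cases h : A ⊆ {0}
  · rw [if_pos h, if_pos ((image_subset_zero_iff e A).mpr h)]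
  · rw [if_neg h, if_neg (mt (image_subset_zero_iff e A).mp h)]

end Thm311ToCor312

end Summit.ABC.IUTFork

end
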